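import Summits.Ventures.HSemireg.WedgeHankelRecurrenceGaussChebyshevFixedPointDivisibility
import Mathlib.RingTheory.AdjoinRoot
import Mathlib.RingTheory.Flat.FaithfullyFlat.Algebra

/-!
# Venture HSemireg — **THE COMMON-FIXED-POINT IDEAL: `(C_m − 2, C_n − 2) = (C_{gcd(m,n)} − 2)` AS IDEALS OF `R[X]` FOR EVERY COMMUTATIVE RING `R`** (the points with `C_m(x) = 2`, i.e. `x = t + t⁻¹` with
# `t^m = 1`, against those with `C_n(x) = 2`), hence **`gcd(V_m − 2, V_n − 2) = |V_{gcd(m,n)} − 2|`** for the Lucas sequence `V_n(P, 1)` (e.g. `P = 3`: `gcd(L_{2m} − 2, L_{2n} − 2) = L_{2 gcd} − 2`).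
# PROOF ROUTE (no Euclidean step exists inside `R[X]`: the cross term `(t^m − 1)(t^n − 1)` is the obstruction): pass to the quadratic extension `B = R[X][t] ∕ (t² − X t + 1)` — free of rank `2`,
# hence FAITHFULLY FLAT over `R[X]` — where `C_k = t^k + t^{−k}` and `C_k − 2 = t^{−k}(t^k − 1)²`; there `((t^m − 1)², (t^n − 1)²) = ((t^g − 1)²)` because `t^m − 1 = (t^g − 1) Σ_{i<m∕g} t^{g i}`
# with GEOMETRIC SUMS OF COPRIME LENGTHS COPRIME (an explicit Euclid on the lengths); finally contract the extended ideals back along the faithfully flat map (`I B ∩ R[X] = I`)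

HONEST FRAMING. Part of the Lean index of the computation cell `pub-hsemireg` (seat p10 gen 48, Sunday typer «UNIFORM-IN-n»).  Commutative algebra of polynomial ideals only; no variety, no cohomology
theory, no sheaf, no Ext group and no semiregularity map is constructed here; nothing here says that HC / HC_CM / HC_AV holds; no Literature fact (unproved `Prop`) is declared or used.  Custodian
versions as in `WedgeHankelSiegelIdeal` (1/3).
SOURCES (cited).  R. Lidl, G. L. Mullen, G. Turnwald, *Dickson Polynomials* (1993), Ch. 3 (fixed points of Dickson permutations `D_n(x, 1)`, counted via `x = t + t⁻¹`); H. Matsumura, *Commutative Ring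
Theory* (1986), Thm 7.5 (faithfully flat ⇒ `IB ∩ A = I`); P. Ribenboim, *My Numbers, My Friends* (2000), Ch. 1 §IV.
PROOF TYPED HERE.  Mathlib `AdjoinRoot` (`root`, `eval₂_root`, `algebraMap_eq`, `powerBasis'`, `Polynomial.Monic.free_adjoinRoot`), `Module.FaithfullyFlat` (instance from `Module.Free` + `Nontrivial`),
`Ideal.comap_map_eq_self_of_faithfullyFlat`, `Ideal.map_span`, `Ideal.span_singleton_mul_left_unit`, `Ideal.span_insert`, `geom_sum_mul`, `Finset.sum_range_add`, `IsCoprime.add_mul_left_right ∕ pow`,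
`Polynomial.Chebyshev.C_add_two ∕ C_zero ∕ C_one`, `Monic.sub_of_left`; N476 `int_gcd_eq_natAbs_of_span_pair_eq`, `lucasV_one_eq_chebyshevC_eval`.
DEDUP DISCLOSURE (`rg -n 'geom_sum_range_add|geom_sum_isCoprime|span_pair_mul_of_isCoprime|span_pair_pow_sub_one_sq|quadExt_|chebyshevC_sub_two_span_pair|lucasV_one_sub_two_gcd' Summits Literature
HarnessLib`, 2026-09-04): `Literature/Algebra/Polynomial/OrderOfPolynomial.lean` `associated_gcd_X_pow_sub_one` (the polynomial `X`, gcd form) and `Literature/Algebra/Homology/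
CyclicGroupRingProductDecomposition.lean` `span_X_pow_sub_one_eq_mul` — different statements (here: an arbitrary ring element, coprime COFACTORS, squared generators); 0 hits for the 10 names below.

WHAT IS IN THE TREE.  N466 (`(C_m, C_n)`), N476, N488 (`C_n − 2 ∣ C_{kn} − 2`).
THIS FILE (namespace `Summit.Ventures.HSemireg.Wedge.HankelOuter` continued; CHAINED on N488; 0 definitions):
* §1254 `geom_sum_range_add`, **`geom_sum_isCoprime`** (coprime lengths ⇒ coprime geometric sums, every commutative ring), `span_pair_mul_of_isCoprime`, `pow_mul_sub_one_eq_mul_geom_sum`,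
  **`span_pair_pow_sub_one_sq`** (`((x^m−1)², (x^n−1)²) = ((x^g−1)²)`), `quadExt_monic_natDegree`, `quadExt_chebyshevC` (`C_k ↦ τ^k + σ^k`), `quadExt_chebyshevC_sub_two`
  (`C_k − 2 ↦ σ^k (τ^k − 1)²`), **`chebyshevC_sub_two_span_pair`**, **`lucasV_one_sub_two_gcd`**.
CAVEATS.  `ℕ` indices (`C_{−m} = C_m`).  The `+2` analogue `(C_m + 2, C_n + 2)` equals `(C_g + 2)` only when `m∕g`, `n∕g` are both odd and is NOT typed here.  Nothing Ext-side.  New names only.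
-/

open Module Polynomial
open scoped Matrix Polynomial

namespace Summit.Ventures.HSemireg.Wedge.HankelOuter

/-! ## §1254. `(C_m − 2, C_n − 2) = (C_{gcd(m,n)} − 2)` -/

/-- Splitting a geometric sum: `Σ_{i<d+m} x^i = Σ_{i<d} x^i + x^d · Σ_{i<m} x^i`. [bookkeeping; this file, §1254] -/
theorem geom_sum_range_add {B : Type*} [CommRing B] (x : B) (d m : ℕ) :
    ∑ i ∈ Finset.range (d + m), x ^ i = ∑ i ∈ Finset.range d, x ^ i + x ^ d * ∑ i ∈ Finset.range m, x ^ i := by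
  rw [Finset.sum_range_add, Finset.mul_sum]
  refine congrArg _ (Finset.sum_congr rfl fun i _ => ?_)
  rw [pow_add]

/-- **Geometric sums of coprime lengths are coprime: `IsCoprime (Σ_{i<m} x^i) (Σ_{i<n} x^i)` whenever `gcd(m,n) = 1`**, for every element `x` of every commutative ring (Euclid on the lengths:
`Σ_{i<d+m} x^i = Σ_{i<d} x^i + x^d Σ_{i<m} x^i`). [this file, §1254] -/
theorem geom_sum_isCoprime {B : Type*} [CommRing B] (x : B) {m n : ℕ} (h : Nat.Coprime m n) :
    IsCoprime (∑ i ∈ Finset.range m, x ^ i) (∑ i ∈ Finset.range n, x ^ i) := by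
  suffices H : ∀ k m n, m + n = k → Nat.Coprime m n → IsCoprime (∑ i ∈ Finset.range m, x ^ i) (∑ i ∈ Finset.range n, x ^ i) from H _ m n rfl h
  intro k
  induction k using Nat.strong_induction_on with
  | _ k ih =>
    intro m n hk h
    rcases Nat.eq_zero_or_pos m with rfl | hm
    · rw [Nat.coprime_zero_left] at h
      subst h
      rw [Finset.sum_range_zero, Finset.sum_range_one, pow_zero]
      exact isCoprime_one_right
    rcases Nat.eq_zero_or_pos n with rfl | hn
    · rw [Nat.coprime_zero_right] at h
      subst h
      rw [Finset.sum_range_zero, Finset.sum_range_one, pow_zero]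
      exact isCoprime_one_left
    rcases le_or_gt m n with hmn | hnm
    · obtain ⟨d, rfl⟩ := Nat.exists_eq_add_of_le hmn
      have hd : Nat.Coprime m d := Nat.coprime_self_add_right.1 h
      have h' := ih (m + d) (by omega) m d rfl hd
      rw [add_comm m d, geom_sum_range_add, mul_comm]
      exact h'.add_mul_left_right _
    · obtain ⟨d, rfl⟩ := Nat.exists_eq_add_of_le hnm.le
      have hd : Nat.Coprime d n := Nat.coprime_self_add_left.1 h |>.symm |> fun h0 => h0.symm
      have h' := ih (d + n) (by omega) d n rfl hd
      rw [add_comm n d, geom_sum_range_add, mul_comm]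
      exact (h'.symm.add_mul_left_right _).symm

/-- `(d·u, d·v) = (d)` when `u`, `v` are coprime. [bookkeeping; this file, §1254] -/
theorem span_pair_mul_of_isCoprime {B : Type*} [CommRing B] {u v : B} (h : IsCoprime u v) (d : B) :
    Ideal.span {d * u, d * v} = Ideal.span {d} := by
  apply le_antisymm
  · rw [Ideal.span_le, Set.insert_subset_iff, Set.singleton_subset_iff]
    exact ⟨Ideal.mem_span_singleton.2 (dvd_mul_right d u), Ideal.mem_span_singleton.2 (dvd_mul_right d v)⟩
  · rw [Ideal.span_singleton_le_iff_mem, Ideal.mem_span_pair]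
    obtain ⟨a, b, hab⟩ := h
    exact ⟨a, b, by linear_combination d * hab⟩

/-- `x^{g k} − 1 = (x^g − 1) · Σ_{i<k} (x^g)^i`. [Mathlib `geom_sum_mul`; this file, §1254] -/
theorem pow_mul_sub_one_eq_mul_geom_sum {B : Type*} [CommRing B] (x : B) (g k : ℕ) :
    x ^ (g * k) - 1 = (x ^ g - 1) * ∑ i ∈ Finset.range k, (x ^ g) ^ i := by
  rw [pow_mul, mul_comm, geom_sum_mul]

/-- **`((x^m − 1)², (x^n − 1)²) = ((x^{gcd(m,n)} − 1)²)`** as ideals, for every element `x` of every commutative ring (coprime cofactors, squared). [this file, §1254] -/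
theorem span_pair_pow_sub_one_sq {B : Type*} [CommRing B] (x : B) (m n : ℕ) :
    Ideal.span {(x ^ m - 1) ^ 2, (x ^ n - 1) ^ 2} = Ideal.span {(x ^ Nat.gcd m n - 1) ^ 2} := by
  obtain ⟨g, hgdef⟩ : ∃ g, Nat.gcd m n = g := ⟨_, rfl⟩
  rw [hgdef]
  rcases Nat.eq_zero_or_pos g with h0 | hg
  · subst h0
    obtain ⟨rfl, rfl⟩ := Nat.gcd_eq_zero_iff.1 hgdef
    rw [Set.pair_eq_singleton]
  obtain ⟨m', hm'⟩ : g ∣ m := hgdef ▸ Nat.gcd_dvd_left m n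
  obtain ⟨n', hn'⟩ : g ∣ n := hgdef ▸ Nat.gcd_dvd_right m n
  have hc := Nat.coprime_div_gcd_div_gcd (hgdef.symm ▸ hg)
  rw [hgdef] at hc
  subst hm' hn'
  rw [Nat.mul_div_cancel_left _ hg, Nat.mul_div_cancel_left _ hg] at hc
  have hu := (geom_sum_isCoprime (x ^ g) hc).pow (m := 2) (n := 2)
  rw [pow_mul_sub_one_eq_mul_geom_sum, pow_mul_sub_one_eq_mul_geom_sum, mul_pow, mul_pow, span_pair_mul_of_isCoprime hu]

/-- The quadratic polynomial `t² − a t + 1` over a nontrivial commutative ring is monic of degree `2`. [bookkeeping; this file, §1254] -/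
theorem quadExt_monic_natDegree {A : Type*} [CommRing A] [Nontrivial A] (a : A) :
    (Polynomial.X ^ 2 - (Polynomial.C a * Polynomial.X - 1) : A[X]).Monic ∧ (Polynomial.X ^ 2 - (Polynomial.C a * Polynomial.X - 1) : A[X]).natDegree = 2 := by
  have hdeg : (Polynomial.C a * Polynomial.X - 1 : A[X]).degree < (Polynomial.X ^ 2 : A[X]).degree := by
    rw [Polynomial.degree_X_pow]
    refine (Polynomial.degree_sub_le _ _).trans_lt (max_lt ((Polynomial.degree_C_mul_X_le a).trans_lt (by exact_mod_cast (by norm_num : (1 : ℕ) < 2))) ?_)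
    exact Polynomial.degree_one_le.trans_lt (by exact_mod_cast (by norm_num : (0 : ℕ) < 2))
  refine ⟨(Polynomial.monic_X_pow 2).sub_of_left hdeg, Polynomial.natDegree_eq_of_degree_eq_some ?_⟩
  rw [Polynomial.degree_sub_eq_left_of_degree_lt hdeg, Polynomial.degree_X_pow]

/-- In an `R[X]`-algebra `B` with elements `τ, σ` satisfying `τ σ = 1`, `τ + σ = X`: **`C_k(X) = τ^k + σ^k`** (`k ∈ ℕ`). [Lidl–Mullen–Turnwald (1.1); this file, §1254] -/
theorem quadExt_chebyshevC {R B : Type*} [CommRing R] [CommRing B] [Algebra R[X] B] {τ σ : B} (hmul : τ * σ = 1) (hadd : τ + σ = algebraMap R[X] B Polynomial.X) (k : ℕ) :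
    algebraMap R[X] B (Polynomial.Chebyshev.C R (k : ℤ)) = τ ^ k + σ ^ k := by
  induction k using Nat.strong_induction_on with
  | _ k ih =>
    rcases k with _ | _ | k
    · rw [Nat.cast_zero, Polynomial.Chebyshev.C_zero, pow_zero, pow_zero, map_ofNat]; norm_num
    · rw [Nat.cast_one, Polynomial.Chebyshev.C_one, pow_one, pow_one, ← hadd]
    · rw [show (((k + 2 : ℕ)) : ℤ) = (k : ℤ) + 2 by push_cast; ring, Polynomial.Chebyshev.C_add_two, map_sub, map_mul, ← hadd,
        show (k : ℤ) + 1 = ((k + 1 : ℕ) : ℤ) by push_cast; ring, ih (k + 1) (by omega), ih k (by omega)]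
      linear_combination (σ ^ k + τ ^ k) * hmul

/-- In the same setting: **`C_k(X) − 2 = σ^k (τ^k − 1)²`**. [this file, §1254] -/
theorem quadExt_chebyshevC_sub_two {R B : Type*} [CommRing R] [CommRing B] [Algebra R[X] B] {τ σ : B} (hmul : τ * σ = 1) (hadd : τ + σ = algebraMap R[X] B Polynomial.X) (k : ℕ) :
    algebraMap R[X] B (Polynomial.Chebyshev.C R (k : ℤ) - 2) = σ ^ k * (τ ^ k - 1) ^ 2 := by
  rw [map_sub, quadExt_chebyshevC hmul hadd k, map_ofNat]
  have h2 : τ ^ k * σ ^ k = 1 := by rw [← mul_pow, hmul, one_pow]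
  linear_combination (-(τ ^ k) + 2) * h2

/-- **THE COMMON-FIXED-POINT IDEAL: `(C_m − 2, C_n − 2) = (C_{gcd(m,n)} − 2)` in `R[X]` for every commutative ring `R`** (via the faithfully flat quadratic extension `R[X][t] ∕ (t² − Xt + 1)`).
[Lidl–Mullen–Turnwald Ch. 3; Matsumura Thm 7.5; this file, §1254] -/
theorem chebyshevC_sub_two_span_pair {R : Type*} [CommRing R] (m n : ℕ) :
    Ideal.span {Polynomial.Chebyshev.C R (m : ℤ) - 2, Polynomial.Chebyshev.C R (n : ℤ) - 2} = Ideal.span {Polynomial.Chebyshev.C R (Nat.gcd m n : ℤ) - 2} := by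
  rcases subsingleton_or_nontrivial R with hR | hR
  · haveI : Subsingleton (Ideal R[X]) := (Submodule.subsingleton_iff R[X]).2 inferInstance
    exact Subsingleton.elim _ _
  -- the quadratic extension `B = R[X][t] / (t² − X t + 1)`
  obtain ⟨hf, hf2⟩ := quadExt_monic_natDegree (Polynomial.X : R[X])
  set f : R[X][X] := Polynomial.X ^ 2 - (Polynomial.C (Polynomial.X : R[X]) * Polynomial.X - 1) with hf_def
  haveI : Module.Free R[X] (AdjoinRoot f) := hf.free_adjoinRoot
  haveI : Nontrivial (AdjoinRoot f) :=
    nontrivial_of_ne _ _ ((AdjoinRoot.powerBasis' hf).basis.ne_zero ⟨0, by rw [AdjoinRoot.powerBasis'_dim, hf2]; norm_num⟩)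
  -- `τ σ = 1`, `τ + σ = X`
  have hroot := AdjoinRoot.eval₂_root f
  rw [← AdjoinRoot.algebraMap_eq, hf_def, eval₂_sub, eval₂_sub, eval₂_pow, eval₂_X, eval₂_mul, eval₂_C, eval₂_X, eval₂_one] at hroot
  have hmul : AdjoinRoot.root f * (algebraMap R[X] (AdjoinRoot f) Polynomial.X - AdjoinRoot.root f) = 1 := by
    linear_combination (-1 : AdjoinRoot f) * hroot
  have hadd : AdjoinRoot.root f + (algebraMap R[X] (AdjoinRoot f) Polynomial.X - AdjoinRoot.root f) = algebraMap R[X] (AdjoinRoot f) Polynomial.X := by ring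
  have hσ : IsUnit (algebraMap R[X] (AdjoinRoot f) Polynomial.X - AdjoinRoot.root f) := IsUnit.of_mul_eq_one (AdjoinRoot.root f) (by rw [mul_comm]; exact hmul)
  -- extended ideals agree
  have key : Ideal.map (algebraMap R[X] (AdjoinRoot f)) (Ideal.span {Polynomial.Chebyshev.C R (m : ℤ) - 2, Polynomial.Chebyshev.C R (n : ℤ) - 2}) =
      Ideal.map (algebraMap R[X] (AdjoinRoot f)) (Ideal.span {Polynomial.Chebyshev.C R (Nat.gcd m n : ℤ) - 2}) := by
    rw [Ideal.map_span, Ideal.map_span, Set.image_pair, Set.image_singleton, quadExt_chebyshevC_sub_two hmul hadd, quadExt_chebyshevC_sub_two hmul hadd,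
      quadExt_chebyshevC_sub_two hmul hadd, Ideal.span_insert, Ideal.span_singleton_mul_left_unit (hσ.pow _), Ideal.span_singleton_mul_left_unit (hσ.pow _),
      Ideal.span_singleton_mul_left_unit (hσ.pow _), ← Ideal.span_insert, span_pair_pow_sub_one_sq]
  rw [← Ideal.comap_map_eq_self_of_faithfullyFlat (B := AdjoinRoot f) (Ideal.span {Polynomial.Chebyshev.C R (m : ℤ) - 2, Polynomial.Chebyshev.C R (n : ℤ) - 2}), key,
    Ideal.comap_map_eq_self_of_faithfullyFlat]

/-- **`gcd(V_m − 2, V_n − 2) = |V_{gcd(m,n)} − 2|`** for `V_0 = 2, V_1 = P, V_{k+2} = P V_{k+1} − V_k` over `ℤ` (e.g. `P = 3`: `gcd(L_{2m} − 2, L_{2n} − 2) = L_{2 gcd(m,n)} − 2`). [this file, §1254] -/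
theorem lucasV_one_sub_two_gcd {P : ℤ} {V : ℕ → ℤ} (hV0 : V 0 = 2) (hV1 : V 1 = P) (hV : ∀ n, V (n + 2) = P * V (n + 1) - V n) (m n : ℕ) :
    Int.gcd (V m - 2) (V n - 2) = (V (Nat.gcd m n) - 2).natAbs := by
  have hev : ∀ k : ℕ, Polynomial.evalRingHom P (Polynomial.Chebyshev.C ℤ (k : ℤ) - 2) = V k - 2 := fun k => by
    rw [map_sub, map_ofNat, Polynomial.coe_evalRingHom, lucasV_one_eq_chebyshevC_eval hV0 hV1 hV k]
  have h := congrArg (Ideal.map (Polynomial.evalRingHom P)) (chebyshevC_sub_two_span_pair (R := ℤ) m n)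
  rw [Ideal.map_span, Ideal.map_span, Set.image_pair, Set.image_singleton, hev, hev, hev] at h
  exact int_gcd_eq_natAbs_of_span_pair_eq h

end Summit.Ventures.HSemireg.Wedge.HankelOuter
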